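import Literature.Analysis.FunctionSpaces.PVHerbrandPIND
import HarnessLib

/-!
# Buss's witnessing theorem in `PV` form: `Σᵇ₁`-definable in `S₂¹` ⇒ `PV`-definable

We prove the witnessing half of Buss's Main Theorem in its machine-independent (Cobham / `PV`)
form: **if `f : ℕ → ℕ` is `Σᵇ₁`-definable in `S₂¹` then `f` is `PV`-definable**, i.e. `f` is the
standard interpretation of a function symbol of Cook's `PV` / a function of Cobham's class
(`isPVDefinable_of_isSigmabDefinable_S2_one`).  This is Buss 1986, Ch. 5, Main Theorem 5
("⇒": every `Σᵇ₁`-definable function of `S₂¹` is in `□ᵖ₁ = FP`, read through Cobham's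
characterisation, Ch. 1 / Ch. 6), Krajíček 1995, Thm. 7.2.3 / Cor. 7.2.4 for `i = 1`; it is one
direction of the named fact `isPVDefinable_iff_isSigmabDefinable` (`PVFunctions.lean`), and
together with Cobham's theorem (`cobham`, ibid.) it gives the witnessing direction
`polyTimeComputable_of_isSigmabDefinable_S2_one` of `buss_witnessing`
(`Literature/Computability/Complexity/BoundedArithmetic.lean`).

## The proof (Zambella 1996; Krajíček 1995, §7.6, Thm. 7.6.3 and pp. 116–117; Avigad 2002, §3–4)

Provability is Mathlib's semantic `⊨ᵇ`, and the proof is model-theoretic throughout.  Let `φ(x, y)`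
be the `Σᵇ₁` graph formula, `S₂¹ ⊨ ∀x ∃y φ`.  By `hasSigmaForm_of_isSigmab_one`
(`PVStrictForms.lean`) there are an open `L(PV)`-formula `ψ(x, y, w)` and a term `T(x, y)` with
`w ≤ T ∧ ψ → φ` in every model of the true universal theory `U = trueUnivPV` of `(ℕ, PV)` (in
particular in `ℕ`) and `φ → ∃ w ≤ T ψ` in every Herbrand-saturated one.  Suppose no pair of `PV`
symbols `g, h` satisfies `∀ n (h n ≤ T(n, g n) ∧ ψ(n, g n, h n))` in `ℕ`.  Since open conditions
have characteristic symbols, candidate pairs combine by cases, so by compactness there is a model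
`N ⊨ U` with an element `a` at which *every* pair fails; the substructure `M` generated by `a` is
again a model of `U` (universal) in which every element is a term in `a`.  Embed `M` into an
Herbrand-saturated `K ⊨ U` preserving universal formulas (Avigad 2002, Thm. 3.2,
`exists_preservesUniversal_isHerbrandSaturated`).  By `model_S2_one_of_isHerbrandSaturated`
(`PVHerbrandPIND.lean`), `K ⊨ S₂¹`, so `K ⊨ ∃ y φ(a, y)`, hence `K ⊨ ∃ y w (w ≤ T ∧ ψ)(a, y, w)`;
this existential statement about `a` reflects to `M`, where `y = t₁(a)`, `w = t₂(a)` are terms —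
i.e. `PV` symbols — contradicting the choice of `a`.  So some `g, h` work; by soundness in `ℕ`,
`φ(n, g n)` for all `n`, and by the uniqueness clause (true in `ℕ ⊨ S₂¹`) `g = f`.

## References

* S. R. Buss, *Bounded Arithmetic*, Bibliopolis 1986, Ch. 5 (Main Theorem), Ch. 6.
* J. Krajíček, *Bounded Arithmetic, Propositional Logic and Complexity Theory*, CUP 1995,
  Thm. 7.2.3, Cor. 7.2.4, Thm. 7.6.3 and pp. 116–117 ("Following Zambella (1994) …").
* D. Zambella, *Notes on polynomially bounded arithmetic*, J. Symbolic Logic 61 (1996) 942–966.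
* J. Avigad, *Saturated models of universal theories*, APAL 118 (2002), Thms. 3.2–3.4, §4.
-/

namespace Literature.Analysis.FunctionSpaces

open FirstOrder FirstOrder.Language FirstOrder.Language.BoundedFormula
open Literature.Computability.MetaComplexity Literature.Computability.MetaComplexity.BASICModel
open Literature.ModelTheory.UniversalTheories

/-! ## Small generic lemmas -/

section Generic

/-- Semantics of the totality sentence in an arbitrary structure (cf. `realize_totalitySentence`
for `ℕ`). [folklore] -/
theorem realize_totalitySentence' {M : Type} [Language.boundedArith.Structure M]
    (φ : Language.boundedArith.Formula (Fin 2)) :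
    (M ⊨ totalitySentence φ) ↔ ∀ a : M, ∃ b : M, φ.Realize ![a, b] := by
  simp only [totalitySentence, Sentence.Realize, Formula.Realize, BoundedFormula.realize_all,
    BoundedFormula.realize_ex, BoundedFormula.realize_relabel, Nat.add_zero, Fin.castAdd_zero,
    Fin.cast_refl, Function.comp_id, Sum.elim_comp_inr]
  refine forall_congr' fun a => exists_congr fun b => ?_
  congr! 1
  ext i; fin_cases i <;> rfl

/-- A `Fin 1`-tuple is `![x 0]`. [folklore] -/
theorem vec_fin1_eq {P : Type} (x : Fin 1 → P) : x = ![x 0] := by funext i; fin_cases i; rfl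

end Generic

/-! ## The failure formulas and candidate selection -/

section Failure

variable {ψ : Language.pv.BoundedFormula Empty 3} {T : Language.boundedArith.Term (Empty ⊕ Fin 2)}

/-- The witnessing condition `w ≤ T(x, y) ∧ ψ(x, y, w)` in the context `(x, y, w)`. [folklore] -/
def witCond (ψ : Language.pv.BoundedFormula Empty 3) (T : Language.boundedArith.Term (Empty ⊕ Fin 2)) :
    Language.pv.BoundedFormula Empty 3 :=
  Term.le (cv 2) (upT T) ⊓ ψ

/-- The instance `witCond (c, g c, h c)` as a formula in the single free variable `c`. [folklore] -/
def witAt (ψ : Language.pv.BoundedFormula Empty 3) (T : Language.boundedArith.Term (Empty ⊕ Fin 2))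
    (g h : PVFun 1) : Language.pv.Formula (Fin 1) :=
  (substCtx (witCond ψ T) ![cv 0, Term.func g ![cv 0], Term.func h ![cv 0] ]).toFormula.relabel
    (Sum.elim Empty.elim (id : Fin 1 → Fin 1))

/-- `witCond` is open when `ψ` is. [folklore] -/
theorem isQF_witCond (hψ : ψ.IsQF) (T : Language.boundedArith.Term (Empty ⊕ Fin 2)) : (witCond ψ T).IsQF :=
  (IsAtomic.rel _ _).isQF.inf hψ

/-- `witAt` is open when `ψ` is. [folklore] -/
theorem isQF_witAt (hψ : ψ.IsQF) (T : Language.boundedArith.Term (Empty ⊕ Fin 2)) (g h : PVFun 1) :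
    (witAt ψ T g h).IsQF := by
  rw [witAt, Formula.relabel]
  exact ((isQF_substCtx (isQF_witCond hψ T) _).toFormula).relabel _

/-- Semantics of `witAt` in an arbitrary `L(PV)`-structure: `witCond (c, g c, h c)`. [folklore] -/
theorem realize_witAt {P : Type} [Language.pv.Structure P] (g h : PVFun 1) (v : Fin 1 → P) :
    (witAt ψ T g h).Realize v ↔
      (witCond ψ T).Realize (default : Empty → P) ![v 0, papp g ![v 0], papp h ![v 0] ] := by
  rw [witAt, Formula.realize_relabel, realize_toFormula]
  have e1 : ((v ∘ Sum.elim Empty.elim (id : Fin 1 → Fin 1)) ∘ Sum.inl : Empty → P) = default := Subsingleton.elim _ _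
  have e2 : ((v ∘ Sum.elim Empty.elim (id : Fin 1 → Fin 1)) ∘ Sum.inr) = v := by funext i; rfl
  rw [e1, e2, realize_substCtx]
  have e3 : (fun i => Term.realize (Sum.elim (default : Empty → P) v)
      ((![cv 0, Term.func g ![cv 0], Term.func h ![cv 0] ] : Fin 3 → Language.pv.Term (Empty ⊕ Fin 1)) i)) =
      ![v 0, papp g ![v 0], papp h ![v 0] ] := by
    funext i
    fin_cases i
    · rfl
    · show papp g _ = papp g ![v 0]
      congr 1; funext j; fin_cases j; rfl
    · show papp h _ = papp h ![v 0]
      congr 1; funext j; fin_cases j; rfl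
  rw [e3]

/-- The candidate selection: given pairs `(g₁, h₁), …`, "the first pair witnessing at `n`, else the
last resort `0`" — a pair of `PV` symbols defined by cases on the characteristic symbol of the
(open) witnessing condition. [folklore] -/
def selPair (ψ : Language.pv.BoundedFormula Empty 3) (T : Language.boundedArith.Term (Empty ⊕ Fin 2)) :
    List (PVFun 1 × PVFun 1) → PVFun 1 × PVFun 1
  | [] => (PVFun.zero', PVFun.zero')
  | gh :: rest =>
    let test : PVFun 1 := PVFun.comp (charSym (witCond ψ T)) ![PVFun.proj 0, gh.1, gh.2]
    (PVFun.ap₃ PVFun.cond test (selPair ψ T rest).1 gh.1, PVFun.ap₃ PVFun.cond test (selPair ψ T rest).2 gh.2)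

/-- **Correctness of the candidate selection in `ℕ`**: if some pair of the list witnesses at `n`,
so does the selected pair. [folklore] -/
theorem selPair_spec (hψ : ψ.IsQF) (L : List (PVFun 1 × PVFun 1)) (n : ℕ)
    (h : ∃ gh ∈ L, (witAt ψ T gh.1 gh.2).Realize ![n]) :
    (witAt ψ T (selPair ψ T L).1 (selPair ψ T L).2).Realize ![n] := by
  induction L with
  | nil => simp at h
  | cons gh rest ih =>
    haveI : ℕ ⊨ BASIC := model_nat_BASIC_holds
    rw [realize_witAt]
    simp only [Matrix.cons_val_zero, papp_nat]
    have hχ := papp_charSym (K := ℕ) model_nat_trueUnivPV (isQF_witCond hψ T) ![n, gh.1.eval ![n], gh.2.eval ![n] ]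
    simp only [papp_nat] at hχ
    have hwit := realize_witAt (ψ := ψ) (T := T) gh.1 gh.2 (![n] : Fin 1 → ℕ)
    simp only [Matrix.cons_val_zero, papp_nat] at hwit
    have etest : (PVFun.comp (charSym (witCond ψ T)) ![PVFun.proj 0, gh.1, gh.2]).eval ![n] =
        (charSym (witCond ψ T)).eval ![n, gh.1.eval ![n], gh.2.eval ![n] ] := by
      rw [PVFun.eval_comp]; congr 1; funext i; fin_cases i <;> rfl
    simp only [selPair, PVFun.eval_ap₃, PVFun.eval_cond, Matrix.cons_val_zero, Matrix.cons_val_one,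
      Matrix.cons_val, etest]
    by_cases hz : (charSym (witCond ψ T)).eval ![n, gh.1.eval ![n], gh.2.eval ![n] ] = 0
    · -- `gh` does not witness at `n`: fall through to the rest of the list
      rw [if_pos hz, if_pos hz]
      have hw : ¬ (witAt ψ T gh.1 gh.2).Realize ![n] := fun hw =>
        absurd ((hχ.1.2 (hwit.1 hw)).symm.trans hz) (Nat.succ_ne_zero 0)
      have ih' := ih ?_
      · rw [realize_witAt] at ih'
        simpa only [Matrix.cons_val_zero, papp_nat] using ih'
      obtain ⟨gh', hmem, hgh'⟩ := h
      rcases List.mem_cons.1 hmem with rfl | hmem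
      · exact absurd hgh' hw
      · exact ⟨gh', hmem, hgh'⟩
    · rw [if_neg hz, if_neg hz]
      exact hχ.1.1 (hχ.2.resolve_left hz)

end Failure

/-! ## The witnessing theorem -/

section Main

variable {ψ : Language.pv.BoundedFormula Empty 3} {T : Language.boundedArith.Term (Empty ⊕ Fin 2)}

/-- **The Zambella step.** If every Herbrand-saturated model of `trueUnivPV` satisfies
`∀ x ∃ y w witCond(x, y, w)` (for an open `ψ`), then some pair of `PV` symbols `g, h` satisfies
`witCond (n, g n, h n)` for every `n ∈ ℕ` (Krajíček 1995, pp. 116–117, after Zambella; Avigad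
2002, Thms. 3.2–3.4). [cite: Krajicek1995, Theorem 7.6.3 and pp. 116–117] -/
theorem exists_pv_witness (hψ : ψ.IsQF)
    (H : ∀ (K : Type) [Language.pv.Structure K], K ⊨ trueUnivPV → IsHerbrandSaturated Language.pv K →
      ∀ x : K, ∃ y w : K, (witCond ψ T).Realize (default : Empty → K) ![x, y, w]) :
    ∃ g h : PVFun 1, ∀ n : ℕ, (witAt ψ T g h).Realize ![n] := by
  classical
  by_contra hcon
  push Not at hcon
  -- the failure sentences about a new constant `c`
  let S : Set (Language.pv.Formula (Fin 1)) := Set.range fun gh : PVFun 1 × PVFun 1 => ∼(witAt ψ T gh.1 gh.2)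
  have hsat : ((Language.pv.lhomWithConstants (Fin 1)).onTheory trueUnivPV ∪
      Formula.equivSentence '' S).IsSatisfiable := by
    rw [Theory.isSatisfiable_iff_isFinitelySatisfiable]
    intro T0 hT0
    -- the finitely many pairs mentioned in `T0`
    let ch : Language.pv[[Fin 1]].Sentence → PVFun 1 × PVFun 1 := fun σ =>
      if hσ : ∃ gh : PVFun 1 × PVFun 1, σ = Formula.equivSentence (∼(witAt ψ T gh.1 gh.2)) then hσ.choose
      else (PVFun.zero', PVFun.zero')
    let L := (T0.image ch).toList
    obtain ⟨n₀, hn₀⟩ := hcon (selPair ψ T L).1 (selPair ψ T L).2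
    have hall : ∀ gh ∈ L, ¬ (witAt ψ T gh.1 gh.2).Realize ![n₀] :=
      fun gh hgh hw => hn₀ (selPair_spec hψ L n₀ ⟨gh, hgh, hw⟩)
    haveI : ℕ ⊨ trueUnivPV := model_nat_trueUnivPV
    have hfin := isSatisfiable_union_image_equivSentence_of_realize (L := Language.pv) trueUnivPV
      ((fun gh : PVFun 1 × PVFun 1 => ∼(witAt ψ T gh.1 gh.2)) '' {gh | gh ∈ L}) ℕ ![n₀] (by
        rintro _ ⟨gh, hgh, rfl⟩
        rw [Formula.realize_not]
        exact hall gh hgh)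
    refine hfin.mono fun σ hσ => ?_
    rcases hT0 hσ with hσ' | ⟨φ', hφ', rfl⟩
    · exact Or.inl hσ'
    · obtain ⟨gh, rfl⟩ := hφ'
      have hex : ∃ gh' : PVFun 1 × PVFun 1, Formula.equivSentence (∼(witAt ψ T gh.1 gh.2)) =
          Formula.equivSentence (∼(witAt ψ T gh'.1 gh'.2)) := ⟨gh, rfl⟩
      have hch : ch (Formula.equivSentence (∼(witAt ψ T gh.1 gh.2))) = hex.choose := dif_pos hex
      have heq : Formula.equivSentence (∼(witAt ψ T gh.1 gh.2)) =
          Formula.equivSentence (∼(witAt ψ T hex.choose.1 hex.choose.2)) := hex.choose_spec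
      refine Or.inr ⟨∼(witAt ψ T hex.choose.1 hex.choose.2), ⟨hex.choose, ?_, rfl⟩, heq.symm⟩
      show hex.choose ∈ L
      rw [Finset.mem_toList, ← hch]
      exact Finset.mem_image_of_mem ch hσ
  -- a model `N` with an element `a` at which every pair fails
  obtain ⟨N, _, _, v, hNT, hv⟩ :=
    (isSatisfiable_union_image_equivSentence_iff (L := Language.pv) trueUnivPV S).1 hsat
  haveI : N ⊨ trueUnivPV := hNT
  -- the substructure generated by `a`
  let M : Language.pv.Substructure N := Substructure.closure Language.pv (Set.range v)
  let a : M := ⟨v 0, Substructure.subset_closure (Set.mem_range_self 0)⟩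
  haveI : M ⊨ trueUnivPV := Substructure.models_of_isUniversal M trueUnivPV
  haveI : Nonempty M := ⟨a⟩
  have hfail : ∀ g h : PVFun 1, ¬ (witCond ψ T).Realize (default : Empty → M) ![a, papp g ![a], papp h ![a] ] := by
    intro g h hw
    have h1 : (witAt ψ T g h).Realize (![a] : Fin 1 → M) := (realize_witAt g h ![a]).2 (by simpa using hw)
    have h2 : (witAt ψ T g h).Realize ((M.subtype : M → N) ∘ ![a]) := by
      have h2' := ((isQF_witAt hψ T g h).realize_embedding M.subtype (v := ![a])
        (xs := (default : Fin 0 → M))).2 h1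
      rwa [Subsingleton.elim ((M.subtype : M → N) ∘ (default : Fin 0 → M)) default] at h2'
    have e : ((M.subtype : M → N) ∘ ![a]) = v := by
      rw [vec_fin1_eq v]; funext i; fin_cases i; rfl
    rw [e] at h2
    exact (Formula.realize_not.1 (hv _ ⟨(g, h), rfl⟩)) h2
  -- an Herbrand-saturated extension preserving universal formulas
  obtain ⟨K, _, _, f, hf, hK⟩ := exists_preservesUniversal_isHerbrandSaturated (L := Language.pv) M
  have hKT : K ⊨ trueUnivPV := hf.model_of_isUniversal trueUnivPV
  obtain ⟨y, w, hyw⟩ := H K hKT hK (f a)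
  -- reflect `∃ y w witCond (f a, y, w)` to `M`
  let χ : Language.pv.BoundedFormula M 2 :=
    BoundedFormula.relabel (Sum.elim Empty.elim ![Sum.inl a, Sum.inr 0, Sum.inr 1]) (witCond ψ T).toFormula
  have hχsem : ∀ (P : Type) [Language.pv.Structure P] (e : M → P) (ys : Fin 2 → P),
      χ.Realize e ys ↔ (witCond ψ T).Realize (default : Empty → P) ![e a, ys 0, ys 1] := by
    intro P _ e ys
    rw [realize_relabel]
    have e3 : (ys ∘ Fin.natAdd 2 : Fin 0 → P) = default := Subsingleton.elim _ _
    rw [e3]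
    refine (realize_toFormula _ _).trans ?_
    have e1 : ((Sum.elim e (ys ∘ Fin.castAdd 0) ∘ Sum.elim Empty.elim ![Sum.inl a, Sum.inr 0, Sum.inr 1]) ∘ Sum.inl :
        Empty → P) = default := Subsingleton.elim _ _
    have e2 : ((Sum.elim e (ys ∘ Fin.castAdd 0) ∘ Sum.elim Empty.elim ![Sum.inl a, Sum.inr 0, Sum.inr 1]) ∘ Sum.inr) =
        ![e a, ys 0, ys 1] := by
      funext i; fin_cases i <;> rfl
    rw [e1, e2]
  have hU : (χ.not.alls : Language.pv.Formula M).IsUniversal := (isQF_witCond hψ T).toFormula.relabel _ |>.not.isUniversal_alls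
  have hM : ¬ (χ.not.alls : Language.pv.Formula M).Realize (id : M → M) := by
    intro hall
    have hK' := hf hU hall
    rw [realize_alls] at hK'
    have hK'' := hK' ![y, w]
    rw [realize_not, hχsem] at hK''
    exact hK'' (by simpa using hyw)
  rw [realize_alls] at hM
  push Not at hM
  simp only [realize_not, not_not] at hM
  obtain ⟨ys, hys⟩ := hM
  rw [hχsem] at hys
  simp only [id] at hys
  -- the witnesses are terms in `a`, i.e. symbols
  obtain ⟨t₁, ht₁⟩ := exists_term_realize_eq_of_mem_closure v (ys 0).2
  obtain ⟨t₂, ht₂⟩ := exists_term_realize_eq_of_mem_closure v (ys 1).2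
  refine hfail (termSym t₁) (termSym t₂) ?_
  have hv' : ((M.subtype : M → N) ∘ ![a]) = v := by
    rw [vec_fin1_eq v]; funext i; fin_cases i; rfl
  have hy : papp (termSym t₁) ![a] = ys 0 := by
    apply Subtype.ext
    rw [papp_termSym (inferInstance : M ⊨ trueUnivPV)]
    have hr := HomClass.realize_term (L := Language.pv) M.subtype (t := t₁) (v := ![a])
    rw [hv', ht₁] at hr
    exact hr.symm
  have hw : papp (termSym t₂) ![a] = ys 1 := by
    apply Subtype.ext
    rw [papp_termSym (inferInstance : M ⊨ trueUnivPV)]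
    have hr := HomClass.realize_term (L := Language.pv) M.subtype (t := t₂) (v := ![a])
    rw [hv', ht₂] at hr
    exact hr.symm
  rw [hy, hw]
  exact hys

/-- **Buss's witnessing theorem, `PV` form** (Buss 1986, Ch. 5, Main Theorem, direction "⇒", with
Ch. 6; Krajíček 1995, Thm. 7.2.3 / Cor. 7.2.4 for `i = 1`; proved model-theoretically after
Zambella 1996 and Avigad 2002): every function `Σᵇ₁`-definable in `S₂¹` is `PV`-definable — it is
the standard interpretation of a function symbol of Cook's `PV`, i.e. lies in Cobham's class.
This is the "→" direction of `isPVDefinable_iff_isSigmabDefinable`. [cite: Buss1986, Ch. 5, Main Theorem 5] -/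
theorem isPVDefinable_of_isSigmabDefinable_S2_one {f : ℕ → ℕ} (hf : IsSigmabDefinable (S2 1) 1 f) :
    IsPVDefinable fun v : Fin 1 → ℕ => f (v 0) := by
  obtain ⟨φ, hφ, hgraph, htot, huniq⟩ := hf
  -- strict form of the graph formula
  have hθ : IsSigmab 1 (QSym.toCtx φ) := hφ.relabel _
  obtain ⟨ψ, T, hψ, hs, hc⟩ := hasSigmaForm_of_isSigmab_one hθ
  -- every Herbrand-saturated model of `trueUnivPV` witnesses totality
  have H : ∀ (K : Type) [Language.pv.Structure K], K ⊨ trueUnivPV → IsHerbrandSaturated Language.pv K →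
      ∀ x : K, ∃ y w : K, (witCond ψ T).Realize (default : Empty → K) ![x, y, w] := by
    intro K _ hK hsat x
    letI : Language.boundedArith.Structure K := boundedArithToPV.reduct K
    haveI : boundedArithToPV.IsExpansionOn K := LHom.isExpansionOn_reduct _ _
    haveI : K ⊨ BASIC := model_BASIC_of_trueUnivPV hK
    haveI : K ⊨ S2 1 := model_S2_one_of_isHerbrandSaturated hK hsat
    have htotK : K ⊨ totalitySentence φ := (Theory.models_sentence_iff.1 htot) (Theory.ModelType.of (S2 1) K)
    obtain ⟨y, hy⟩ := (realize_totalitySentence' φ).1 htotK x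
    have hθy : (QSym.toCtx φ).Realize (default : Empty → K) ![x, y] := (QSym.realize_toCtx φ _).2 hy
    obtain ⟨w, hw, hψw⟩ := hc K hK hsat ![x, y] hθy
    refine ⟨y, w, ?_⟩
    simp only [witCond, realize_inf, realize_pvle, Term.realize, Sum.elim_inr]
    refine ⟨?_, by simpa using hψw⟩
    have e : (![x, y, w] : Fin 3 → K) = Fin.snoc ![x, y] w := by funext i; fin_cases i <;> rfl
    rw [e, realize_upT]
    simpa [mLe_iff] using hw
  obtain ⟨g, h, hgh⟩ := exists_pv_witness hψ H
  refine ⟨g, funext fun v => ?_⟩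
  -- soundness in `ℕ` and uniqueness
  have hφg : ∀ n : ℕ, φ.Realize ![n, g.eval ![n] ] := by
    intro n
    have hw := (realize_witAt g h ![n]).1 (hgh n)
    simp only [Matrix.cons_val_zero, papp_nat] at hw
    simp only [witCond, realize_inf, Term.realize_le, Term.realize, Sum.elim_inr, Matrix.cons_val] at hw
    have e : (![(n : ℕ), g.eval ![n], h.eval ![n] ] : Fin 3 → ℕ) = Fin.snoc ![n, g.eval ![n] ] (h.eval ![n]) := by
      funext i; fin_cases i <;> rfl
    rw [e] at hw
    obtain ⟨hle, hψn⟩ := hw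
    simp only [realize_upT] at hle
    have hθn := hs ℕ model_nat_trueUnivPV ![n, g.eval ![n] ] (h.eval ![n]) ((mLe_nat _ _).2 hle) hψn
    exact (QSym.realize_toCtx φ _).1 hθn
  haveI : ℕ ⊨ S2 1 := model_nat_S2_holds 1
  have huniqN : ℕ ⊨ uniquenessSentence φ := (Theory.models_sentence_iff.1 huniq) (Theory.ModelType.of (S2 1) ℕ)
  rw [realize_uniquenessSentence] at huniqN
  rw [vec_fin1_eq v]
  exact (huniqN (v 0) (f (v 0)) (g.eval ![v 0]) (hgraph (v 0)) (hφg (v 0))).symm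

end Main

end Literature.Analysis.FunctionSpaces
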